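import Literature.MathematicalPhysics.QuantumFieldTheory.Balaban1983to89.B9Thm34HolderLeftFinal
import Literature.MathematicalPhysics.QuantumFieldTheory.Balaban1983to89.B9Thm34AllUniform

/-!
# `Balaban1983to89.B9Thm34HolderLeftUniform` — [Balaban1985BackgroundPropagators] THEOREM 3.4 p. 400, THE HÖLDER MEMBERS (3.43) («‖ζ∇_UG′λ‖_β,
# ‖ζG′∇*_Uλ‖_β», Theorem 3.3's «‖ζ∇_UGJ‖_β») FOR THE CONCRETE `G′(U′U)` AND `G(U′U)` WITH THE CONSTANTS CHOSEN BEFORE THE LATTICE: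
# `∃ a₁ > 0 ∃ B ∀ (T_η, k, {Ω_j}, U, …) ∀ α₁ ≦ a₁ ∀ A ∀ (functional Φ, …)` — FILE 34's three final theorems re-quantified (FILE 54 of the Sect. B
# programme of cell `lit-balaban`, seat r06 gen 21; the Hölder half of B9-CLOSURE §3 item 4's remainder «FILES 34–44 keep the per-lattice shape»)

statement-level skeleton of published theorems with citation tags; proofs where landed; nothing here is a claim about the Yang–Mills mass gap

CITATION HEADER (lean-in-tree rule).  B9 = T. Bałaban, *Propagators for lattice gauge theories in a background field*, Commun. Math. Phys.
**99** (1985) 389–434 [Balaban1985BackgroundPropagators] (held `paper:balaban1985-cmp99-background-propagators`; journal page = PDF page + 388):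
Theorem 3.4 p. 400 [PDF 12] L7–10 «There exists a positive constant a₁ such that the operators G′(U), (Q′(U)G′²(U)Q′*(U))⁻¹, R(U), G(U) extend
to configurations U′U for α₁ ≦ a₁ as analytic functions of A. The extended operators satisfy all the inequalities of Theorems 3.1–3.3
correspondingly»; Theorem 3.1 p. 397 [PDF 9] «There exist positive constants M₁, δ₀, a₀, B₀ dependent on d and L only» and (3.43) p. 398 [PDF 10]
«‖ζ∇_UG′(U)λ‖_β, ‖ζG′(U)∇*_Uλ‖_β ≦ B₀(β₀)(Lʲη)^{1−β}·(‖ζ‖_β^ξ + |ζ|)e^{−δ₀d(y,y′)}|λ|, ξ = L^{−j}, for 0 ≦ β ≦ β₀ < 1, ζ ∈ C₀^∞(Δ̃(y)), y ∈ Λ_j,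
supp λ ⊂ Δ(y′)»; the Hölder norm (3.40) p. 397; Theorem 3.3 p. 399 [PDF 11] «the operator G(U) (a = 1) satisfies the inequalities (3.42)–(3.47),
with G′(U) replaced by G(U) and λ replaced by a function J defined at bonds of the lattice»; p. 399 L1–3 «Let us stress that the constants in the
formulations of both theorems do not depend on the sequence {Ω_j}, j = 0, 1, …, k, if the conditions (2.1), (2.2) are satisfied»; p. 403 [PDF 15]
l. 1–9 «Now applying Theorem 3.1 for G′(U), the bound (3.63), the representation (3.64) and Lemma 2.1 of [4] we can prove all the statements
(3.42)–(3.47) of Theorem 3.1 for the operator G′(U′U), of course with different constants»; p. 407 [PDF 19] «Thus Theorem 3.4 is proved, assuming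
that Theorems 3.1–3.3 hold»; (3.62)–(3.65) pp. 402–403, (3.84)–(3.86) p. 407; p. 398 remark after (3.47) (scale transfer).  [4] =
[Balaban1984PropagatorsII] (2.51)–(2.55) p. 232, Lemma 2.1 p. 234 [PDF 12] (no dependence on the torus, k or {Ω_j}).  Rows B9.Thm3.4 × B9.Thm3.1
((3.43) cell) × B9.Thm3.3 × B9.Eq3.62 × B9.Eq3.85 (cells only; no row head changes).

WHY THIS FILE (B9-CLOSURE §3 item 4 / v3.3 «what keeps the per-lattice shape (same recipe, INTERFACES-r06 §46/§47): … the Hölder/L² members FILES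
34–44»; FILE 34 HONEST SCOPE (e) «`a₁`, `B` packaged existentially after the lattice is fixed (values depend on the constants only)»).  FILE 34
states the (3.43)-type Hölder transfers as `∀ (lattice, background, letters) ∃ a₁ ∃ B ∀ α₁ ∀ A ∀ (D, Φ, y, p₀, β, B_h, c_ζ) …`; the constants are
computed from FILE 26/28's constants, `Σ_i‖b_i‖`, `M₂`, `B_G`, `B₀` and (§6) one continuity bound and the scale transfer at exponent `1/25` only.
Here (as in FILES 45–53) the p. 398 / [4] Lemma 2.1 scale transfer is hypothesised in its printed uniform form (ONE function `Λ : (0,∞) → [1,∞)` for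
the family), the per-lattice callees FILE 26 `thm34_Gp_final` / FILE 28 `thm34_all_final` are replaced by their uniform twins FILE 45
`thm34_Gp_uniform` / FILE 48 `thm34_all_uniform` invoked BEFORE the lattice, and the quantifiers are re-ordered.

WHAT IS PROVED (3 theorems: 0 `def`, 0 sorry, 0 new named facts; standard axioms).
* **`thm34_Gp_holderLeft_uniform`** — FILE 34 §4 `thm34_Gp_holderLeft_final` (every (3.43)-type bound `‖Φ(D G′(U)λ)‖ ≦ B_h(Lʲη)^{1−β}c_ζ
  e^{−δ₀d(y,y′)}|λ|` on an `ℝ`-linear functional `Φ` of the output, any left letter `D`, transfers to `G′(U′U)` at `(B·B_h, 9δ₀/10)`) with the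
  quantifier order `∃ a₁ > 0 ∃ B ≧ 0 ∀ S T U g blk kQ sQ cfun w (axioms, [4] Lemma 2.1, scale transfer with the GIVEN Λ(·), (3.19)/(3.24)/(3.60)
  data, Theorem 3.1 for G′(U) = (Δ′_a(U))⁻¹) ∀ α₁ ≦ a₁ ∀ A kF sF … ∀ D Φ y p₀ β B_h c_ζ …`; `B = (Σ_i‖b_i‖)M₂B⁽⁴⁵⁾/B_G`.
* **`thm34_all_holderLeft_uniform`** — FILE 34 §5 `thm34_all_holderLeft_final` (the same clause for `G′(U′U)` at `(B, 9δ₀/10)` AND, for THE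
  `C⁻¹(U′U), G(U′U)` of FILE 28/48 (defining identities re-exported), the clause for `G(U′U)` on the bond carrier at `(B, δ₀/6)` — Theorem 3.3's
  member «‖ζ∇_UG(U′U)J‖_β» from «‖ζ∇_UG(U)J‖_β») with the quantifier order `∃ a₁ > 0 ∃ B ≧ 0 ∀ (lattice, background, letters, section,
  Theorems 3.1–3.3 for U incl. kernel members) ∀ α₁ ≦ a₁ ∀ A … ∀ (3.57)/(3.59) letters ∀ (3.80)–(3.82) letters …`; the lattice-free sign
  hypothesis `0 < B₀` (FILE 34's last binder) is hoisted next to `hΛf`; `B = (Σ_i‖b_i‖)M₂B⁽⁴⁸⁾(1/B_G + 1/B₀)`.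
* **`thm34_Gp_holderRight_uniform`** — FILE 34 §6 `thm34_Gp_holderRight_final` (the (3.43) member WITH THE DERIVATIVE ON THE RIGHT for
  `G′(U′U)`: inputs (a) the Hölder quotient of `ζG′(U)λ` itself, (b) «‖ζG′(U)∇_kλ‖_β» for every concrete `∇_k`, (c) the member for the right
  letter `D`; conclusion `‖Φ(G′(U′U)Dλ)‖ ≦ B·B_h(Lʲη)^{1−β}c_ζe^{−(9δ₀/10)d(y,y′)}|λ|`) with the same quantifier order; the continuity bound
  `θ_L(1) ≦ K` (FILE 25 `exists_bound_of_continuousAt`, read at `Λ(1/100)`) and the scale-transfer constant `Λ(1/25)` fixed before the lattice;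
  `B = (Σ_i‖b_i‖)M₂(1 + K·B⁽⁴⁵⁾Λ(1/25)c₁(δ₀,1/25))`, `a₁ = min(a₁⁽⁴⁵⁾, 1/4, ε/2)`.
(FILE 34's per-lattice statements follow by instantiation with `Λf := fun _ => Λ`; hypotheses inside each `∀` = FILE 34's VERBATIM (named binders),
less `hrepr` (moved before) and with `hST` in the uniform form.)

PROOF.  FILE 34's proofs verbatim after the re-ordering (scripted: `work/unif.py` + `work/gen54.py` in the seat folder): the uniform callees and the
lattice-free constants/thresholds BEFORE the lattice; inside, the callees' `∀`-clauses applied to the lattice data (`replace h := h T U blk …`), then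
FILE 34's §1–§3 devices (`norm_probe_transfer`, `probe_transfer`, `thetaL363_linear`, …) and gen 9's left composite BY NAME.

HONEST SCOPE / NOT CLAIMED.  As FILE 34: (a) Theorems 3.1–3.3 FOR `U` are inputs — the (3.43)-type bound for `U` is the hypothesis of each
clause, per functional; (b) `Φ` arbitrary (`ℝ`-linear, `𝔸`-valued): the metric, contours, transport `R(U(Γ))` and cut-off `ζ` of (3.40)/(3.43)
decide which functionals and weights are fed in; (c) derivative and transport of `U` on both sides («conventional», p. 398); (d) §6's extra input
(a) (the Hölder quotient of `ζG′(U)λ` itself) as in FILE 34; (e) the uniformity displayed is uniformity in `(S, T, 𝔅, blk)`, `U`, the operators,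
the letters and the functionals AT FIXED input constants, `κ`, `(𝔸, b)`, `Λ(·)` — the print's «dependent on d and L only» is this composed with
Theorems 3.1–3.3's own uniformity and [4] Lemma 2.1; the rates `9δ₀/10`, `δ₀/6` are FILE 45/48's; (3.44)–(3.46) are FILES 37–44's business
(per-lattice there).  NOT summit progress.

RELATED IN THE TREE, NOT DUPLICATED (searched 2026-08-23: `lean search 'holderLeft_uniform|holderRight_uniform' --decl` = ∅): FILE 34
`B9Thm34HolderLeftFinal` (per-lattice finals; §1–§3 devices USED BY NAME), FILE 45 `B9Thm34SectBUniform.thm34_Gp_uniform`, FILE 48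
`B9Thm34AllUniform.thm34_all_uniform`, gen 9 `B9Ineq363Vprime.hasMajorant_gp_vPrime`, `B9Ineq366CPrime.hasMajorant_comp_decay_left1`, FILE 25
`B9Thm34GKernelFinal.exists_bound_of_continuousAt` — all USED BY NAME; no existing module modified.
-/

noncomputable section

namespace Literature.MathematicalPhysics.QuantumFieldTheory.Balaban1983to89.B9Thm34HolderLeftUniform

open NormedSpace Complex
open Literature.MathematicalPhysics.QuantumFieldTheory.Balaban1983to89
open Literature.MathematicalPhysics.QuantumFieldTheory.Balaban1983to89.B6RandomWalk (HasMajorant BlockSupp hasMajorant_mono Triangle254 Ineq261)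
open Literature.MathematicalPhysics.QuantumFieldTheory.Balaban1983to89.B6RandomWalkHom (HasMajorantHom)
open Literature.MathematicalPhysics.QuantumFieldTheory.Balaban1983to89.B6RandomWalkKernel (HasKernelBound)
open Literature.MathematicalPhysics.QuantumFieldTheory.Balaban1983to89.B6RandomWalkSection (secExt secRes secConj)
open Literature.MathematicalPhysics.QuantumFieldTheory.Balaban1983to89.B9Thm34Ext (toB6)
open Literature.MathematicalPhysics.QuantumFieldTheory.Balaban1983to89.B9Ineq347 (ScaleTransfer)
open Literature.MathematicalPhysics.QuantumFieldTheory.Balaban1983to89.B9Eq386Neumann (pTwo deltaA)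
open Literature.MathematicalPhysics.QuantumFieldTheory.Balaban1983to89.B9Eq39Adjoint
open Literature.MathematicalPhysics.QuantumFieldTheory.Balaban1983to89.B9Eq369Small (Through)
open Literature.MathematicalPhysics.QuantumFieldTheory.Balaban1983to89.B9Eq372Locality (stBonds)
open Literature.MathematicalPhysics.QuantumFieldTheory.Balaban1983to89.B9Eq352DivForm (tauF tauB)
open Literature.MathematicalPhysics.QuantumFieldTheory.Balaban1983to89.B9Eq352DivFormLetters
open Literature.MathematicalPhysics.QuantumFieldTheory.Balaban1983to89.B9Eq352GradLetters (diffLetter)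
open Literature.MathematicalPhysics.QuantumFieldTheory.Balaban1983to89.B9Eq371GradLetters (bT bU)
open Literature.MathematicalPhysics.QuantumFieldTheory.Balaban1983to89.B9Eq372RemLetters (lapDDLetter)
open Literature.MathematicalPhysics.QuantumFieldTheory.Balaban1983to89.B9Eq382V3Letters (dPrimeLetter)
open Literature.MathematicalPhysics.QuantumFieldTheory.Balaban1983to89.B9Eq376POneLetters (conjHom gradLin divLin)
open Literature.MathematicalPhysics.QuantumFieldTheory.Balaban1983to89.B9Eq360Vprime (gPrimeExtEnd)
open Literature.MathematicalPhysics.QuantumFieldTheory.Balaban1983to89.B9Eq360VprimeLetters (vPrimeConc)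
open Literature.MathematicalPhysics.QuantumFieldTheory.Balaban1983to89.B9Thm34SectBUniform (thm34_Gp_uniform)
open Literature.MathematicalPhysics.QuantumFieldTheory.Balaban1983to89.B9Thm34AllUniform (thm34_all_uniform)
open Literature.MathematicalPhysics.QuantumFieldTheory.Balaban1983to89.B9Ineq385VG (kappa385)
open Literature.MathematicalPhysics.QuantumFieldTheory.Balaban1983to89.B9Eq360VprimeLetters (cBConc)
open Literature.MathematicalPhysics.QuantumFieldTheory.Balaban1983to89.B9Ineq363Vprime (cVConc thetaL363 thetaL363_nonneg hasMajorant_gp_vPrime)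
open Literature.MathematicalPhysics.QuantumFieldTheory.Balaban1983to89.B9Ineq366CPrime (hasMajorant_rate_mono hasMajorant_comp_decay_left1)
open Literature.MathematicalPhysics.QuantumFieldTheory.Balaban1983to89.B9Thm34GKernelFinal (exists_bound_of_continuousAt)
open Literature.MathematicalPhysics.QuantumFieldTheory.Balaban1983to89.B6RandomWalk (hasMajorant_add)
open Literature.MathematicalPhysics.QuantumFieldTheory.Balaban1983to89.B9Thm34HolderLeftFinal (hasMajorant_pointProbe_mul
  probe_le_of_hasMajorant_pointProbe_mul probe_transfer norm_le_sum_norm_mul_of_repr_le norm_probe_transfer pointProbe_apply coordProbe_apply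
  holderQuot340_apply thetaL363_linear)

section HolderU1

variable {𝔸 : Type*} [NormedRing 𝔸] [NormedAlgebra ℂ 𝔸] [CompleteSpace 𝔸] {ι : Type} [Fintype ι]
variable (b : Module.Basis ι ℝ 𝔸) (κ : Type) [Fintype κ]

set_option maxHeartbeats 800000 in
/-- **THEOREM 3.4, THE (3.43)-TYPE HÖLDER MEMBERS OF `G′(U′U)` WITH THE DERIVATIVE ON THE LEFT, CONSTANTS BEFORE THE LATTICE** («The extended
operators satisfy all the inequalities of Theorems 3.1–3.3 correspondingly», p. 400; «the constants … do not depend on the sequence {Ω_j}», p. 399;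
(3.43) p. 398): for fixed `d`, `κ`, `(𝔸, b, M₂)`, input constants and ONE scale-transfer function `Λ(·) ≧ 1`, THERE EXIST `a₁ > 0`, `B ≧ 0` such that
FOR EVERY lattice `(S, T)`, geometry `𝔅 = g` with `blk`, background `U`, (3.19)/(3.24)/(3.60) data and `G′(U) = (Δ′_a(U))⁻¹` with Theorem 3.1
(3.42)₁₋₃ at `(B_G, δ₀)`: for all `0 ≦ α₁ ≦ a₁`, all `A` in (3.37) (blockwise), (3.59) kernels, every left letter `D`, every `ℝ`-linear `𝔸`-valued
functional `Φ`, anchor `y ∋ p₀`, `β`, `B_h, c_ζ ≧ 0`: IF `‖Φ(D G′(U)λ)‖ ≦ B_h(Lʲη)^{1−β}c_ζe^{−δ₀d(y,y′)}|λ|` for every `λ` supported in `Δ(y′)`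
((3.43) for `U` read for this functional) THEN `‖Φ(D G′(U′U)λ)‖ ≦ B·B_h(Lʲη)^{1−β}c_ζe^{−(9δ₀/10)d(y,y′)}|λ|` — FILE 34 `thm34_Gp_holderLeft_final`
verbatim, re-quantified (`B = (Σ_i‖b_i‖)M₂B⁽⁴⁵⁾/B_G`).
[cite: Balaban1985BackgroundPropagators, Thm 3.4 p.400 + p.399 + Thm 3.1 (3.43) p.398 + (3.40) p.397 + (3.62)–(3.65) pp.402–403 + p.403 l.1–9; Balaban1984PropagatorsII, (2.51) p.232 + Lemma 2.1 p.234] -/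
theorem thm34_Gp_holderLeft_uniform [DecidableEq ι] (d : ℕ)
    (δ₀ BG Cq a₀ d₀ M₂ : ℝ) (Λf : ℝ → ℝ)
    (hBG : 0 < BG) (hCq : 0 ≤ Cq) (ha₀ : 0 ≤ a₀) (hM₂ : 0 ≤ M₂) (hδ₀ : 0 < δ₀) (hΛf : ∀ α : ℝ, 0 < α → 1 ≤ Λf α)
    (hrepr : ∀ (v : 𝔸) (i : ι), |b.repr v i| ≤ M₂ * ‖v‖) :
    ∃ a₁ : ℝ, 0 < a₁ ∧ ∃ B : ℝ, 0 ≤ B ∧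
    ∀ {S : Type} [Fintype S] [DecidableEq S] (T : κ → Equiv.Perm S) (U : κ → S → 𝔸ˣ)
      {g : B9.Geometry} [Fintype g.Site] [DecidableEq g.Site] [Nonempty g.Site] {Rr : ℝ} {H : Prop} (blk : S → g.Site)
      (kQ : g.Site → S → 𝔸 →L[ℝ] 𝔸) (sQ : S → 𝔸 →L[ℝ] 𝔸) (cfun w : g.Site → ℝ)
    -- the multiscale geometry 𝔅 (p. 393, [4] (2.1)–(2.4)) and its axioms
    (hdnn : ∀ a a' : g.Site, 0 ≤ g.dist a a') (htri : Triangle254 (toB6 g Rr H)) (hrefl : ∀ y : g.Site, g.dist y y = 0)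
    (hsym : ∀ y y' : g.Site, g.dist y y' = g.dist y' y) (hlen : ∀ y : g.Site, 0 < g.len y) (hlenη : ∀ y : g.Site, g.eta ≤ g.len y)
    (hη : 0 < g.eta)
    -- [4] Lemma 2.1 (2.61) at the rate `δ₀`, «for every 0 < α < 1», and the p. 398 scale transfer for every exponent
    (h261 : ∀ α : ℝ, 0 < α → α < 1 → Ineq261 d (toB6 g Rr H) δ₀ α)
      (hST : ∀ α : ℝ, 0 < α → ScaleTransfer g δ₀ α (Λf α) (fun a => g.len a) ∧ ScaleTransfer g δ₀ α (Λf α) (fun a => g.len a ^ 2) ∧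
        ScaleTransfer g δ₀ α (Λf α) (fun a => (g.len a)⁻¹) ∧ ScaleTransfer g δ₀ α (Λf α) (fun a => (g.len a ^ 2)⁻¹) ∧
        ScaleTransfer g δ₀ α (Λf α) (fun a => (g.len a ^ 4)⁻¹) ∧ ScaleTransfer g δ₀ α (Λf α) (fun y => g.len y ^ (-(4 : ℝ))))
    (hU1 : ∀ m z, ‖((U m z : 𝔸ˣ) : 𝔸)‖ ≤ 1 ∧ ‖(((U m z)⁻¹ : 𝔸ˣ) : 𝔸)‖ ≤ 1)
    (hd₀B : ∀ μ x, g.dist (blk x) (blk ((T μ).symm x)) ≤ d₀) (hd₀F : ∀ μ x, g.dist (blk x) (blk (T μ x)) ≤ d₀)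
    (hd₀0 : ∀ y : g.Site, g.dist y y ≤ d₀)
    -- the `A`-independent data of the concrete `V′(A)` of (3.60)
    (hw : ∀ y, 0 ≤ w y) (hcard : ∀ y, ((B9Eq360Vprime.block blk y).card : ℝ) * w y ≤ 1)
    (hkQ : ∀ y x, blk x = y → ‖kQ y x‖ ≤ w y) (hsQ : ∀ x, ‖sQ x‖ ≤ 1) (hcfun : ∀ y, |cfun y| ≤ a₀ * (g.len y ^ 2)⁻¹)
    -- THEOREM 3.1 for `G′(U)`: (3.24) `G′(U) = (Δ′_a(U))⁻¹` for the letter `Δ′_a(U)`, and (3.42)₁,₂,₃ at the rate `δ₀`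
    {Δp Gp : Module.End ℝ (S × ι → ℝ)} (hΔpGp : Δp * Gp = 1) (hGpΔp : Gp * Δp = 1)
    (h342_1 : HasMajorant (g := toB6 g Rr H) (fun p : S × ι => blk p.1) Gp
      (fun a a' => BG * g.len a ^ 2 * Real.exp (-(δ₀ * g.dist a a'))))
    (h342_2 : ∀ k : κ ⊕ κ, HasMajorant (g := toB6 g Rr H) (fun p : S × ι => blk p.1)
      (conj b (diffLetter T U ((g.eta : ℂ)⁻¹) k) * Gp) (fun a a' => BG * g.len a * Real.exp (-(δ₀ * g.dist a a'))))
    (h342_3 : ∀ k : κ ⊕ κ, HasMajorant (g := toB6 g Rr H) (fun p : S × ι => blk p.1)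
      (Gp * conj b (diffLetter T U ((g.eta : ℂ)⁻¹) k)) (fun a a' => BG * g.len a * Real.exp (-(δ₀ * g.dist a a')))),
    ∀ (α₁ : ℝ), 0 ≤ α₁ → α₁ ≤ a₁ →
    -- the exponent field `A` in the domain (3.37), read blockwise, and the `A`-dependent (3.59) data `kF`, `sF`
    ∀ (A : κ → S → 𝔸) (kF : g.Site → S → 𝔸 →L[ℝ] 𝔸) (sF : S → 𝔸 →L[ℝ] 𝔸),
      (∀ y x, blk x = y → ‖kF y x‖ ≤ Cq * α₁ * w y) → (∀ x, ‖sF x‖ ≤ Cq * α₁) →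
      (∀ ν k x, ‖((g.eta : ℂ)⁻¹) • covDstar T U ν (A k) x‖ ≤ α₁ * (g.len (blk x) ^ 2)⁻¹) →
      (∀ μ ν x, ‖((g.eta : ℂ)⁻¹) • covD T U μ (A ν) x‖ ≤ α₁ * (g.len (blk x) ^ 2)⁻¹) →
      (∀ μ x, ‖((g.eta : ℂ)⁻¹) • covDstar T U μ (tauB T U μ (A μ)) x‖ ≤ α₁ * (g.len (blk x) ^ 2)⁻¹) →
      (∀ k x, ‖A k x‖ ≤ α₁ * (g.len (blk x))⁻¹) → (∀ ν k x, ‖tauB T U ν (A k) x‖ ≤ α₁ * (g.len (blk x))⁻¹) →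
      -- NEW: the (3.43)-type Hölder members, derivative (any left letter `D`) on the left, functional `Φ` of the output, anchor `y ∋ p₀`
      ∀ (D : Module.End ℝ (S × ι → ℝ)) (Φ : (S → 𝔸) →ₗ[ℝ] 𝔸) (y : g.Site) (p₀ : S × ι), blk p₀.1 = y →
      ∀ (β Bh cζ : ℝ), 0 ≤ Bh → 0 ≤ cζ →
        (∀ (y' : g.Site) (μ : S × ι → ℝ) (M : ℝ), BlockSupp (g := toB6 g Rr H) (fun p : S × ι => blk p.1) μ y' M →
          ‖Φ ((coordEquiv b).symm (D (Gp μ)))‖ ≤ Bh * g.len y ^ (1 - β) * cζ * Real.exp (-(δ₀ * g.dist y y')) * M) →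
        ∀ (y' : g.Site) (μ : S × ι → ℝ) (M : ℝ), BlockSupp (g := toB6 g Rr H) (fun p : S × ι => blk p.1) μ y' M →
          ‖Φ ((coordEquiv b).symm (D ((gPrimeExtEnd Gp (conj b (vPrimeConc T U g.eta A blk kQ kF sQ sF cfun) * Gp)) μ)))‖ ≤
            B * Bh * g.len y ^ (1 - β) * cζ * Real.exp (-(9 / 10 * δ₀ * g.dist y y')) * M := by
  classical
  obtain ⟨a₁, ha₁, B', hB', HA⟩ := thm34_Gp_uniform b κ d δ₀ BG Cq a₀ d₀ M₂ Λf hBG hCq ha₀ hM₂ hδ₀ hΛf hrepr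
  have hSb : 0 ≤ ∑ i, ‖b i‖ := Finset.sum_nonneg fun i _ => norm_nonneg _
  refine ⟨a₁, ha₁, (∑ i, ‖b i‖) * M₂ * (B' / BG), mul_nonneg (mul_nonneg hSb hM₂) (div_nonneg hB' hBG.le), ?_⟩
  -- NOW the lattice, the background, the data, the Theorems-for-`U` inputs (block and kernel members); then `α₁`, `A` and the `A`-letters
  intro S _ _ T U g _ _ _ Rr H blk kQ sQ cfun w hdnn htri hrefl hsym hlen hlenη hη h261 hST hU1 hd₀B hd₀F hd₀0 hw hcard hkQ hsQ hcfun Δp Gp hΔpGp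
    hGpΔp h342_1 h342_2 h342_3 α₁ hα₁0 hα₁1 A kF sF hkF hsF h337B h337F h337Bτ hA hAτB D Φ y p₀ hp₀ β Bh cζ hBh hcζ hhyp y' μ M hμ
  replace HA := HA T U blk kQ sQ cfun w hdnn htri hrefl hsym hlen hlenη hη h261 hST hU1 hd₀B hd₀F hd₀0 hw hcard hkQ hsQ hcfun hΔpGp hGpΔp h342_1
    h342_2 h342_3
  obtain ⟨-, -, hGpL, -⟩ := HA α₁ hα₁0 hα₁1 A kF sF hkF hsF h337B h337F h337Bτ hA hAτB
  have hc : 0 ≤ Bh * g.len y ^ (1 - β) * cζ := mul_nonneg (mul_nonneg hBh (Real.rpow_nonneg (hlen y).le _)) hcζ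
  have key := norm_probe_transfer b (G := toB6 g Rr H) (fun p : S × ι => blk p.1) (G₁ := Gp) (G₂ := (gPrimeExtEnd Gp (conj b (vPrimeConc T U g.eta A blk kQ kF sQ sF cfun) * Gp)))
    (E₁ := fun a a' => Real.exp (-(δ₀ * g.dist a a'))) (E₂ := fun a a' => Real.exp (-(9 / 10 * δ₀ * g.dist a a')))
    hBG hM₂ (fun a a' => Real.exp_nonneg _) hrepr hGpL D Φ p₀ hc (fun z ν C hν => by
      have h1 := hhyp z ν C hν
      rw [show g.dist y z = g.dist (blk p₀.1) z by rw [hp₀]] at h1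
      simpa only [mul_assoc] using h1) y' μ M hμ
  rw [hp₀] at key
  calc ‖Φ ((coordEquiv b).symm (D ((gPrimeExtEnd Gp (conj b (vPrimeConc T U g.eta A blk kQ kF sQ sF cfun) * Gp)) μ)))‖
      ≤ (∑ i, ‖b i‖) * M₂ * (B' / BG) * (Bh * g.len y ^ (1 - β) * cζ) * Real.exp (-(9 / 10 * δ₀ * g.dist y y')) * M := key
    _ = (∑ i, ‖b i‖) * M₂ * (B' / BG) * Bh * g.len y ^ (1 - β) * cζ * Real.exp (-(9 / 10 * δ₀ * g.dist y y')) * M := by ring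

end HolderU1

section HolderU2

variable {𝔸 : Type*} [NormedRing 𝔸] [NormedAlgebra ℂ 𝔸] [CompleteSpace 𝔸] {ι : Type} [Fintype ι]
variable (b : Module.Basis ι ℝ 𝔸) (κ : Type) [Fintype κ] [LinearOrder κ]

set_option maxHeartbeats 1600000 in
/-- **THEOREM 3.4, THE (3.43)-TYPE HÖLDER MEMBERS WITH THE DERIVATIVE ON THE LEFT, FOR `G′(U′U)` AND FOR THE `G(U′U)` OF FILE 48 TOGETHER,
CONSTANTS BEFORE THE LATTICE** («The extended operators satisfy all the inequalities of Theorems 3.1–3.3 correspondingly», p. 400; Theorem 3.3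
p. 399 «with G′(U) replaced by G(U) and λ replaced by a function J»; «the constants … do not depend on the sequence {Ω_j}», p. 399; p. 407 «Thus
Theorem 3.4 is proved, assuming that Theorems 3.1–3.3 hold»): `∃ a₁ > 0 ∃ B ≧ 0 ∀ (lattice 𝔅 = g, background U, data, Theorems 3.1–3.3 for U incl.
kernel members; 0 < B₀ hoisted before) ∀ α₁ ≦ a₁ ∀ A ∈ (3.37) ∀ (3.57)/(3.59) letters ∀ (3.80)–(3.82) letters`: (i) `G′(U′U)` is the two-sided inverse
of `Δ′_a(U) − V′(A)` with the Hölder-left transfer at `(B, 9δ₀/10)`; `∃ C⁻¹(U′U), G(U′U)` (FILE 48's pair, defining identities re-exported) with the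
Hölder-left transfer for `G(U′U)` on the bond carrier at `(B, δ₀/6)`: for every left letter `D`, functional `Φ`, anchor `y ∋ p₀`, `β`, `B_h, c_ζ ≧
0`: `‖Φ(D G(U)J)‖ ≦ B_h(Lʲη)^{1−β}c_ζe^{−δ₀d(y,y′)}|J|` (all `J` supported in `Δ(y′)`) ⇒ `‖Φ(D G(U′U)J)‖ ≦ B·B_h(Lʲη)^{1−β}c_ζe^{−(δ₀/6)d(y,y′)}|J|`
— FILE 34 `thm34_all_holderLeft_final` verbatim, re-quantified (`B = (Σ_i‖b_i‖)M₂B⁽⁴⁸⁾(1/B_G + 1/B₀)`).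
[cite: Balaban1985BackgroundPropagators, Thm 3.4 p.400 + p.399 + Thm 3.1 (3.43) p.398 + Thm 3.3 p.399 + (3.40) p.397 + (3.62)–(3.65) pp.402–403 + (3.84)–(3.86) p.407; Balaban1984PropagatorsII, (2.51) p.232 + Lemma 2.1 p.234] -/
theorem thm34_all_holderLeft_uniform [DecidableEq ι] (d : ℕ)
    (δ₀ B₀ κQ BG B₁ cF Cq a₀ C₀ d₀ M₂ κQb cFb abar : ℝ) (Λf : ℝ → ℝ)
    (hB₀ : 0 ≤ B₀) (hκQ : 0 < κQ) (hBG : 0 < BG) (hB₁ : 0 < B₁) (hcF : 0 < cF) (hCq : 0 ≤ Cq) (ha₀ : 0 ≤ a₀) (hC₀ : 0 ≤ C₀)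
    (hM₂ : 0 ≤ M₂) (hδ₀ : 0 < δ₀) (hκQb : 0 ≤ κQb) (hcFb : 0 ≤ cFb) (habar : 0 ≤ abar) (hΛf : ∀ α : ℝ, 0 < α → 1 ≤ Λf α) (hB₀' : 0 < B₀)
    (hrepr : ∀ (v : 𝔸) (i : ι), |b.repr v i| ≤ M₂ * ‖v‖) :
    ∃ a₁ : ℝ, 0 < a₁ ∧ ∃ B : ℝ, 0 ≤ B ∧
    ∀ {S : Type} [Fintype S] [DecidableEq S] (T : κ → Equiv.Perm S) (U : κ → S → 𝔸ˣ)
      {g : B9.Geometry} [Fintype g.Site] [DecidableEq g.Site] [Nonempty g.Site] {Rr : ℝ} {H : Prop} (blk : S → g.Site)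
      (kQ : g.Site → S → 𝔸 →L[ℝ] 𝔸) (sQ : S → 𝔸 →L[ℝ] 𝔸) (cfun w : g.Site → ℝ)
    -- the multiscale geometry 𝔅 (p. 393, [4] (2.1)–(2.4)) and its axioms
    (hdnn : ∀ a a' : g.Site, 0 ≤ g.dist a a') (htri : Triangle254 (toB6 g Rr H)) (hrefl : ∀ y : g.Site, g.dist y y = 0)
    (hsym : ∀ y y' : g.Site, g.dist y y' = g.dist y' y) (hlen : ∀ y : g.Site, 0 < g.len y) (hlenη : ∀ y : g.Site, g.eta ≤ g.len y)
    (hη : 0 < g.eta) (hL : 1 ≤ g.L)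
    -- [4] Lemma 2.1 (2.61) at the rate `δ₀`, «for every 0 < α < 1»
    (h261 : ∀ α : ℝ, 0 < α → α < 1 → Ineq261 d (toB6 g Rr H) δ₀ α)
    -- p. 398: «Using Lemma 2.1 in [4] we may replace the factor (Lʲη)^α by (Lʲη)^β(L^{j′}η)^γ with β + γ = α» — for every exponent, one
    -- constant `Λ(α) ≧ 1` for the six weights `(Lʲη)^{1,2,−1,−2,−4}` (natural and real powers)
      (hST : ∀ α : ℝ, 0 < α → ScaleTransfer g δ₀ α (Λf α) (fun a => g.len a) ∧ ScaleTransfer g δ₀ α (Λf α) (fun a => g.len a ^ 2) ∧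
        ScaleTransfer g δ₀ α (Λf α) (fun a => (g.len a)⁻¹) ∧ ScaleTransfer g δ₀ α (Λf α) (fun a => (g.len a ^ 2)⁻¹) ∧
        ScaleTransfer g δ₀ α (Λf α) (fun a => (g.len a ^ 4)⁻¹) ∧ ScaleTransfer g δ₀ α (Λf α) (fun y => g.len y ^ (-(4 : ℝ))))
    -- real coordinates of `𝔸`, commuting translations, unitary-type background
    (hT : ∀ (μ ν : κ) (x : S), T μ (T ν x) = T ν (T μ x))
    (hU1 : ∀ m z, ‖((U m z : 𝔸ˣ) : 𝔸)‖ ≤ 1 ∧ ‖(((U m z)⁻¹ : 𝔸ˣ) : 𝔸)‖ ≤ 1)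
    -- (3.35) on the plaquettes through each bond, at that bond's block scale; stencil geometry at range `d₀`
    (h35 : ∀ μ x m n y, Through T μ x m n y → ‖(plaqU T U m n y : 𝔸) - 1‖ ≤ C₀ * ((g.L ^ g.scale (blk x))⁻¹) ^ 2)
    (hd₀B : ∀ μ x, g.dist (blk x) (blk ((T μ).symm x)) ≤ d₀) (hd₀F : ∀ μ x, g.dist (blk x) (blk (T μ x)) ≤ d₀)
    (hd₀FB : ∀ μ ν x, g.dist (blk x) (blk ((T ν).symm (T μ x))) ≤ d₀)
    (hd₀st : ∀ μ x (q : κ × S), q ∈ stBonds T μ x → g.dist (blk x) (blk q.2) ≤ d₀)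
    (hd₀loc : ∀ μ x (q : κ × S), q ∈ B9Eq375Locality.locBondsA' T μ x → g.dist (blk x) (blk q.2) ≤ d₀)
    (hd₀0 : ∀ y : g.Site, g.dist y y ≤ d₀)
    -- the `A`-independent data of the concrete `V′(A)` of (3.60): (3.19) kernels/multipliers and the `a`-weights of (3.24)
    (hw : ∀ y, 0 ≤ w y) (hcard : ∀ y, ((B9Eq360Vprime.block blk y).card : ℝ) * w y ≤ 1)
    (hkQ : ∀ y x, blk x = y → ‖kQ y x‖ ≤ w y) (hsQ : ∀ x, ‖sQ x‖ ≤ 1) (hcfun : ∀ y, |cfun y| ≤ a₀ * (g.len y ^ 2)⁻¹)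
    -- THEOREM 3.1 for `G′(U)`: (3.42)₁,₂,₃ at the rate `δ₀`
    {Gp : Module.End ℝ (S × ι → ℝ)}
    (h342_1 : HasMajorant (g := toB6 g Rr H) (fun p : S × ι => blk p.1) Gp
      (fun a a' => BG * g.len a ^ 2 * Real.exp (-(δ₀ * g.dist a a'))))
    (h342_2 : ∀ k : κ ⊕ κ, HasMajorant (g := toB6 g Rr H) (fun p : S × ι => blk p.1)
      (conj b (diffLetter T U ((g.eta : ℂ)⁻¹) k) * Gp) (fun a a' => BG * g.len a * Real.exp (-(δ₀ * g.dist a a'))))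
    (h342_3 : ∀ k : κ ⊕ κ, HasMajorant (g := toB6 g Rr H) (fun p : S × ι => blk p.1)
      (Gp * conj b (diffLetter T U ((g.eta : ℂ)⁻¹) k)) (fun a a' => BG * g.len a * Real.exp (-(δ₀ * g.dist a a'))))
    -- (3.24): `G′(U) = (Δ′_a(U))⁻¹` for the letter `Δ′_a(U)`
    {Δp : Module.End ℝ (S × ι → ℝ)} (hΔpGp : Δp * Gp = 1) (hGpΔp : Gp * Δp = 1)
    -- the (3.19) letters `Q′(U)`, `Q′*(U)` in their own typing with block-local two-space majorants, a section of the block map (FILE 17)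
    (rep : g.Site → S × ι) (hrep : ∀ y : g.Site, blk (rep y).1 = y)
    {Qc : (S × ι → ℝ) →ₗ[ℝ] (g.Site → ℝ)} {Qcs : (g.Site → ℝ) →ₗ[ℝ] (S × ι → ℝ)} {Linv : Module.End ℝ (g.Site → ℝ)}
    (hQc : HasMajorantHom (g := toB6 g Rr H) (fun p : S × ι => blk p.1) (fun y : g.Site => y) Qc
      (fun a a' : g.Site => κQ * (if a = a' then (1 : ℝ) else 0)))
    (hQcs : HasMajorantHom (g := toB6 g Rr H) (fun y : g.Site => y) (fun p : S × ι => blk p.1) Qcs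
      (fun a a' : g.Site => κQ * (if a = a' then (1 : ℝ) else 0)))
    -- THEOREM 3.2 for `U`: (3.21) `C⁻¹ = (Q′G′²Q′*)⁻¹` exists (`hLinv`) with the KERNEL bound (3.48) at the rate `δ₀`
    (hLinv : (Qc ∘ₗ (Gp * Gp) ∘ₗ Qcs) * Linv = 1)
    (h348 : ∀ y y' : g.Site, |B9Thm34Inv.ker (B9Thm34Inv.vol g d) Linv y y'| ≤
      B₁ * g.len y ^ (-(4 : ℝ)) * g.len y' ^ (-(d : ℝ)) * Real.exp (-(δ₀ * g.dist y y')))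
    -- the (3.15) bond letters `Q(U)`, `Q*(U)` and the weight letter `a` of (3.24)/(3.26), with their majorants
    {G Qs Q a : Module.End ℝ ((κ × S) × ι → ℝ)}
    (hQb : HasMajorant (g := toB6 g Rr H) (fun q : (κ × S) × ι => blk q.1.2) Q (fun a a' => κQb * Real.exp (-(δ₀ * g.dist a a'))))
    (hQsb : HasMajorant (g := toB6 g Rr H) (fun q : (κ × S) × ι => blk q.1.2) Qs (fun a a' => κQb * Real.exp (-(δ₀ * g.dist a a'))))
    (ha324 : HasMajorant (g := toB6 g Rr H) (fun q : (κ × S) × ι => blk q.1.2) a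
      (fun a a' : g.Site => if a = a' then abar * (g.len a ^ 2)⁻¹ else 0))
    -- THEOREM 3.3 for `G(U)`: two-sided inverse of the concrete `Δ_a(U)` and its (3.42)-entries at the rate `δ₀`
    (hΔG : deltaA (conj b (lapDDLetter T ((g.eta : ℂ)⁻¹) U)) (conj b (dPrimeLetter T U g.eta))
      (conjHom b (gradLin T ((g.eta : ℂ)⁻¹) U) ∘ₗ (1 - (Gp ∘ₗ Qcs ∘ₗ Linv ∘ₗ Qc ∘ₗ Gp)) ∘ₗ conjHom b (divLin T ((g.eta : ℂ)⁻¹) U)) Qs a Q * G = 1)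
    (hGΔ : G * deltaA (conj b (lapDDLetter T ((g.eta : ℂ)⁻¹) U)) (conj b (dPrimeLetter T U g.eta))
      (conjHom b (gradLin T ((g.eta : ℂ)⁻¹) U) ∘ₗ (1 - (Gp ∘ₗ Qcs ∘ₗ Linv ∘ₗ Qc ∘ₗ Gp)) ∘ₗ conjHom b (divLin T ((g.eta : ℂ)⁻¹) U)) Qs a Q = 1)
    (hG : HasMajorant (g := toB6 g Rr H) (fun q : (κ × S) × ι => blk q.1.2) G
      (fun a a' => B₀ * g.len a ^ 2 * Real.exp (-(δ₀ * g.dist a a'))))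
    (hDG : ∀ k : κ ⊕ κ, HasMajorant (g := toB6 g Rr H) (fun q : (κ × S) × ι => blk q.1.2)
      (conj b (diffLetter (bT T) (bU U) ((g.eta : ℂ)⁻¹) k) * G) (fun a a' => B₀ * g.len a * Real.exp (-(δ₀ * g.dist a a'))))
    (hGD : ∀ k : κ ⊕ κ, HasMajorant (g := toB6 g Rr H) (fun q : (κ × S) × ι => blk q.1.2)
      (G * conj b (diffLetter (bT T) (bU U) ((g.eta : ℂ)⁻¹) k)) (fun a a' => B₀ * g.len a * Real.exp (-(δ₀ * g.dist a a'))))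
    -- NEW (kernel form): Theorem 3.3's (3.42)₁,₂,₃,₄ for `G(U)` as PRINTED KERNEL BOUNDS (pairing weight `c = η^d`, volume weight `v(y′) = (L^j′ η)^d`)
    {v : g.Site → ℝ} (hv : ∀ y, 0 < v y) {c : ℝ} (hc : 0 < c)
    (hGk : HasKernelBound (g := toB6 g Rr H) (fun q : (κ × S) × ι => blk q.1.2) v c G
      (fun a a' => B₀ * g.len a ^ 2 * Real.exp (-(δ₀ * g.dist a a'))))
    (hDGk : ∀ k : κ ⊕ κ, HasKernelBound (g := toB6 g Rr H) (fun q : (κ × S) × ι => blk q.1.2) v c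
      (conj b (diffLetter (bT T) (bU U) ((g.eta : ℂ)⁻¹) k) * G) (fun a a' => B₀ * g.len a * Real.exp (-(δ₀ * g.dist a a'))))
    (hGDk : ∀ l : κ ⊕ κ, HasKernelBound (g := toB6 g Rr H) (fun q : (κ × S) × ι => blk q.1.2) v c
      (G * conj b (diffLetter (bT T) (bU U) ((g.eta : ℂ)⁻¹) l)) (fun a a' => B₀ * g.len a * Real.exp (-(δ₀ * g.dist a a'))))
    (hDGDk : ∀ k l : κ ⊕ κ, HasKernelBound (g := toB6 g Rr H) (fun q : (κ × S) × ι => blk q.1.2) v c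
      (conj b (diffLetter (bT T) (bU U) ((g.eta : ℂ)⁻¹) k) * G * conj b (diffLetter (bT T) (bU U) ((g.eta : ℂ)⁻¹) l)) (fun a a' => B₀ * Real.exp (-(δ₀ * g.dist a a')))),
    ∀ (α₁ : ℝ), 0 ≤ α₁ → α₁ ≤ a₁ →
    -- the exponent field `A` in the domain (3.37), read blockwise in the shapes of FILES 1–19, and the `A`-dependent (3.59) data `kF`, `sF`
    ∀ (A : κ → S → 𝔸) (kF : g.Site → S → 𝔸 →L[ℝ] 𝔸) (sF : S → 𝔸 →L[ℝ] 𝔸),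
      (∀ y x, blk x = y → ‖kF y x‖ ≤ Cq * α₁ * w y) → (∀ x, ‖sF x‖ ≤ Cq * α₁) →
      (∀ ν k x, ‖((g.eta : ℂ)⁻¹) • covDstar T U ν (A k) x‖ ≤ α₁ * (g.len (blk x) ^ 2)⁻¹) →
      (∀ μ ν x, ‖((g.eta : ℂ)⁻¹) • covD T U μ (A ν) x‖ ≤ α₁ * (g.len (blk x) ^ 2)⁻¹) →
      (∀ μ ν x, ‖((g.eta : ℂ)⁻¹) • covDstar T U ν (A ν) (T μ x)‖ ≤ α₁ * (g.len (blk x) ^ 2)⁻¹) →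
      (∀ μ x, ‖((g.eta : ℂ)⁻¹) • covDstar T U μ (tauB T U μ (A μ)) x‖ ≤ α₁ * (g.len (blk x) ^ 2)⁻¹) →
      (∀ μ ν k x, ‖((g.eta : ℂ)⁻¹) • covD T U μ (A k) ((T ν).symm x)‖ ≤ α₁ * (g.len (blk x) ^ 2)⁻¹) →
      (∀ k x, ‖A k x‖ ≤ α₁ * (g.len (blk x))⁻¹) → (∀ ν k x, ‖tauB T U ν (A k) x‖ ≤ α₁ * (g.len (blk x))⁻¹) →
      (∀ μ k x, ‖tauF T U μ (A k) x‖ ≤ α₁ * (g.len (blk x))⁻¹) →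
      (∀ k μ ν x, ‖A k ((T ν).symm (T μ x))‖ ≤ α₁ * (g.len (blk x))⁻¹) →
      (∀ μ x m z, (m, z) ∈ stBonds T μ x → ‖A m z‖ ≤ α₁ * (g.len (blk x))⁻¹) →
      (∀ μ x m z, (m, z) ∈ B9Eq375Locality.locBondsA T μ x → ‖A m z‖ ≤ α₁ * (g.len (blk x))⁻¹) →
      (∀ μ x m n y, Through T μ x m n y →
        ‖covD T U m (A n) y‖ ≤ g.eta * (α₁ * ((g.len (blk x))⁻¹) ^ 2) ∧ ‖covD T U n (A m) y‖ ≤ g.eta * (α₁ * ((g.len (blk x))⁻¹) ^ 2)) →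
    -- the (3.57)/(3.59) letters `F′₂(A)`, `F′₂*(A)` (block-local, size `c_F α₁`)
    ∀ {Qc' Fc : (S × ι → ℝ) →ₗ[ℝ] (g.Site → ℝ)} {Qcs' Fcs : (g.Site → ℝ) →ₗ[ℝ] (S × ι → ℝ)},
      Qc' = Qc + Fc → Qcs' = Qcs + Fcs →
      HasMajorantHom (g := toB6 g Rr H) (fun p : S × ι => blk p.1) (fun y : g.Site => y) Fc
        (fun a a' : g.Site => cF * α₁ * (if a = a' then (1 : ℝ) else 0)) →
      HasMajorantHom (g := toB6 g Rr H) (fun y : g.Site => y) (fun p : S × ι => blk p.1) Fcs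
        (fun a a' : g.Site => cF * α₁ * (if a = a' then (1 : ℝ) else 0)) →
    -- the (3.80)–(3.81) letters `F₂(A)`, `F₂*(A)` («|F₂(A)|, |F₂*(A)| ≦ O(1)α₁»), `P₂(A)` of (3.82)
    ∀ {P₂ Qs' Q' F₂ F₂s : Module.End ℝ ((κ × S) × ι → ℝ)},
      Q' = Q + F₂ → Qs' = Qs + F₂s → P₂ = pTwo Qs Q F₂ F₂s a →
      HasMajorant (g := toB6 g Rr H) (fun q : (κ × S) × ι => blk q.1.2) F₂ (fun a a' => cFb * α₁ * Real.exp (-(δ₀ * g.dist a a'))) →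
      HasMajorant (g := toB6 g Rr H) (fun q : (κ × S) × ι => blk q.1.2) F₂s (fun a a' => cFb * α₁ * Real.exp (-(δ₀ * g.dist a a'))) →
      -- (i) `G′(U′U)`: the two-sided inverse of `Δ′_a(U) − V′(A)` (FILE 28, re-exported) and NEW: its Hölder-left members
      (Δp - conj b (vPrimeConc T U g.eta A blk kQ kF sQ sF cfun)) * (gPrimeExtEnd Gp (conj b (vPrimeConc T U g.eta A blk kQ kF sQ sF cfun) * Gp)) = 1 ∧
      (gPrimeExtEnd Gp (conj b (vPrimeConc T U g.eta A blk kQ kF sQ sF cfun) * Gp)) * (Δp - conj b (vPrimeConc T U g.eta A blk kQ kF sQ sF cfun)) = 1 ∧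
      (∀ (D : Module.End ℝ (S × ι → ℝ)) (Φ : (S → 𝔸) →ₗ[ℝ] 𝔸) (y : g.Site) (p₀ : S × ι), blk p₀.1 = y →
        ∀ (β Bh cζ : ℝ), 0 ≤ Bh → 0 ≤ cζ →
        (∀ (y' : g.Site) (μ : S × ι → ℝ) (M : ℝ), BlockSupp (g := toB6 g Rr H) (fun p : S × ι => blk p.1) μ y' M →
          ‖Φ ((coordEquiv b).symm (D (Gp μ)))‖ ≤ Bh * g.len y ^ (1 - β) * cζ * Real.exp (-(δ₀ * g.dist y y')) * M) →
        ∀ (y' : g.Site) (μ : S × ι → ℝ) (M : ℝ), BlockSupp (g := toB6 g Rr H) (fun p : S × ι => blk p.1) μ y' M →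
          ‖Φ ((coordEquiv b).symm (D ((gPrimeExtEnd Gp (conj b (vPrimeConc T U g.eta A blk kQ kF sQ sF cfun) * Gp)) μ)))‖ ≤
            B * Bh * g.len y ^ (1 - β) * cζ * Real.exp (-(9 / 10 * δ₀ * g.dist y y')) * M) ∧
    ∃ (Tinv : Module.End ℝ (g.Site → ℝ)) (GExt : Module.End ℝ ((κ × S) × ι → ℝ)),
      -- (ii) `C⁻¹(U′U)` = THE two-sided inverse of `Q′(U′U)G′²(U′U)Q′*(U′U)` (FILE 28, re-exported)
      Tinv * (Qc' ∘ₗ ((gPrimeExtEnd Gp (conj b (vPrimeConc T U g.eta A blk kQ kF sQ sF cfun) * Gp)) * (gPrimeExtEnd Gp (conj b (vPrimeConc T U g.eta A blk kQ kF sQ sF cfun) * Gp))) ∘ₗ Qcs') = 1 ∧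
      (Qc' ∘ₗ ((gPrimeExtEnd Gp (conj b (vPrimeConc T U g.eta A blk kQ kF sQ sF cfun) * Gp)) * (gPrimeExtEnd Gp (conj b (vPrimeConc T U g.eta A blk kQ kF sQ sF cfun) * Gp))) ∘ₗ Qcs') * Tinv = 1 ∧
      -- (iii) `G(U′U)` = THE two-sided inverse of the concrete `Δ_a(U′U)` built with this `C⁻¹(U′U)` (FILE 28, re-exported) and NEW: its Hölder-left members
      deltaA (conj b (lapDDLetter T ((g.eta : ℂ)⁻¹) (prodCfg U g.eta A)))
          (conj b (dPrimeLetter T (prodCfg U g.eta A) g.eta))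
          (conjHom b (gradLin T ((g.eta : ℂ)⁻¹) (prodCfg U g.eta A)) ∘ₗ (1 - ((Gp ∘ₗ Qcs ∘ₗ Linv ∘ₗ Qc ∘ₗ Gp) + (B9Eq360Vprime.pPrime Gp (gPrimeExtEnd Gp (conj b (vPrimeConc T U g.eta A blk kQ kF sQ sF cfun) * Gp)) (Qcs ∘ₗ secRes rep) (Qcs' ∘ₗ secRes rep) (secConj rep Linv) (secConj rep Tinv) (secExt rep ∘ₗ Qc) (secExt rep ∘ₗ Qc'))))
            ∘ₗ conjHom b (divLin T ((g.eta : ℂ)⁻¹) (prodCfg U g.eta A))) Qs' a Q' * GExt = 1 ∧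
      GExt *
      deltaA (conj b (lapDDLetter T ((g.eta : ℂ)⁻¹) (prodCfg U g.eta A)))
          (conj b (dPrimeLetter T (prodCfg U g.eta A) g.eta))
          (conjHom b (gradLin T ((g.eta : ℂ)⁻¹) (prodCfg U g.eta A)) ∘ₗ (1 - ((Gp ∘ₗ Qcs ∘ₗ Linv ∘ₗ Qc ∘ₗ Gp) + (B9Eq360Vprime.pPrime Gp (gPrimeExtEnd Gp (conj b (vPrimeConc T U g.eta A blk kQ kF sQ sF cfun) * Gp)) (Qcs ∘ₗ secRes rep) (Qcs' ∘ₗ secRes rep) (secConj rep Linv) (secConj rep Tinv) (secExt rep ∘ₗ Qc) (secExt rep ∘ₗ Qc'))))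
            ∘ₗ conjHom b (divLin T ((g.eta : ℂ)⁻¹) (prodCfg U g.eta A))) Qs' a Q' = 1 ∧
      (∀ (D : Module.End ℝ ((κ × S) × ι → ℝ)) (Φ : (κ × S → 𝔸) →ₗ[ℝ] 𝔸) (y : g.Site) (p₀ : (κ × S) × ι), blk p₀.1.2 = y →
        ∀ (β Bh cζ : ℝ), 0 ≤ Bh → 0 ≤ cζ →
        (∀ (y' : g.Site) (μ : (κ × S) × ι → ℝ) (M : ℝ), BlockSupp (g := toB6 g Rr H) (fun q : (κ × S) × ι => blk q.1.2) μ y' M →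
          ‖Φ ((coordEquiv b).symm (D (G μ)))‖ ≤ Bh * g.len y ^ (1 - β) * cζ * Real.exp (-(δ₀ * g.dist y y')) * M) →
        ∀ (y' : g.Site) (μ : (κ × S) × ι → ℝ) (M : ℝ), BlockSupp (g := toB6 g Rr H) (fun q : (κ × S) × ι => blk q.1.2) μ y' M →
          ‖Φ ((coordEquiv b).symm (D (GExt μ)))‖ ≤
            B * Bh * g.len y ^ (1 - β) * cζ * Real.exp (-(δ₀ / 6 * g.dist y y')) * M)
 := by
  classical
  obtain ⟨a₁, ha₁, B', hB', HALL⟩ := thm34_all_uniform b κ d δ₀ B₀ κQ BG B₁ cF Cq a₀ C₀ d₀ M₂ κQb cFb abar Λf hB₀ hκQ hBG hB₁ hcF hCq ha₀ hC₀ hM₂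
    hδ₀ hκQb hcFb habar hΛf hrepr
  have hSb : 0 ≤ ∑ i, ‖b i‖ := Finset.sum_nonneg fun i _ => norm_nonneg _
  have hK₁ : 0 ≤ (∑ i, ‖b i‖) * M₂ * (B' / BG) := mul_nonneg (mul_nonneg hSb hM₂) (div_nonneg hB' hBG.le)
  have hK₂ : 0 ≤ (∑ i, ‖b i‖) * M₂ * (B' / B₀) := mul_nonneg (mul_nonneg hSb hM₂) (div_nonneg hB' hB₀'.le)
  refine ⟨a₁, ha₁, (∑ i, ‖b i‖) * M₂ * (B' / BG) + (∑ i, ‖b i‖) * M₂ * (B' / B₀), add_nonneg hK₁ hK₂, ?_⟩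
  -- NOW the lattice, the background, the data, the Theorems-for-`U` inputs (block and kernel members); then `α₁`, `A` and the `A`-letters
  intro S _ _ T U g _ _ _ Rr H blk kQ sQ cfun w hdnn htri hrefl hsym hlen hlenη hη hL h261 hST hT hU1 h35 hd₀B hd₀F hd₀FB hd₀st hd₀loc hd₀0 hw hcard
    hkQ hsQ hcfun Gp h342_1 h342_2 h342_3 Δp hΔpGp hGpΔp rep hrep Qc Qcs Linv hQc hQcs hLinv h348 G Qs Q a hQb hQsb ha324 hΔG hGΔ hG hDG hGD v hv c
    hc hGk hDGk hGDk hDGDk α₁ hα₁0 hα₁1 A kF sF hkF hsF h337B h337F h337B' h337Bτ h337FB hA hAτB hAτF hAFB hAst hAloc hdAst Qc' Fc Qcs' Fcs h357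
    h357s hFc hFcs P₂ Qs' Q' F₂ F₂s h380 h380s hP₂def hF₂ hF₂s
  replace HALL := HALL T U blk kQ sQ cfun w hdnn htri hrefl hsym hlen hlenη hη hL h261 hST hT hU1 h35 hd₀B hd₀F hd₀FB hd₀st hd₀loc hd₀0 hw hcard hkQ
    hsQ hcfun h342_1 h342_2 h342_3 hΔpGp hGpΔp rep hrep hQc hQcs hLinv h348 hQb hQsb ha324 hΔG hGΔ hG hDG hGD hv hc hGk hDGk hGDk hDGDk
  obtain ⟨i1, i2, hGpL, -, Tinv, GExt, e1, e2, -, -, -, -, -, -, -, -, -, e3, e4, hGL, -, -, -, -, -⟩ := HALL α₁ hα₁0 hα₁1 A kF sF hkF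
    hsF h337B h337F h337B' h337Bτ h337FB hA hAτB hAτF hAFB hAst hAloc hdAst h357 h357s hFc hFcs h380 h380s hP₂def hF₂ hF₂s
  refine ⟨i1, i2, ?_, Tinv, GExt, e1, e2, e3, e4, ?_⟩
  · intro D Φ y p₀ hp₀ β Bh cζ hBh hcζ hhyp y' μ M hμ
    have hcw : 0 ≤ Bh * g.len y ^ (1 - β) * cζ := mul_nonneg (mul_nonneg hBh (Real.rpow_nonneg (hlen y).le _)) hcζ
    have key := norm_probe_transfer b (G := toB6 g Rr H) (fun p : S × ι => blk p.1) (G₁ := Gp) (G₂ := (gPrimeExtEnd Gp (conj b (vPrimeConc T U g.eta A blk kQ kF sQ sF cfun) * Gp)))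
      (E₁ := fun a a' => Real.exp (-(δ₀ * g.dist a a'))) (E₂ := fun a a' => Real.exp (-(9 / 10 * δ₀ * g.dist a a')))
      hBG hM₂ (fun a a' => Real.exp_nonneg _) hrepr hGpL D Φ p₀ hcw (fun z ν C hν => by
        have h1 := hhyp z ν C hν
        rw [show g.dist y z = g.dist (blk p₀.1) z by rw [hp₀]] at h1
        simpa only [mul_assoc] using h1) y' μ M hμ
    rw [hp₀] at key
    have hE : 0 ≤ Real.exp (-(9 / 10 * δ₀ * g.dist y y')) := Real.exp_nonneg _
    calc ‖Φ ((coordEquiv b).symm (D ((gPrimeExtEnd Gp (conj b (vPrimeConc T U g.eta A blk kQ kF sQ sF cfun) * Gp)) μ)))‖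
        ≤ (∑ i, ‖b i‖) * M₂ * (B' / BG) * (Bh * g.len y ^ (1 - β) * cζ) * Real.exp (-(9 / 10 * δ₀ * g.dist y y')) * M := key
      _ ≤ ((∑ i, ‖b i‖) * M₂ * (B' / BG) + (∑ i, ‖b i‖) * M₂ * (B' / B₀)) * (Bh * g.len y ^ (1 - β) * cζ) *
            Real.exp (-(9 / 10 * δ₀ * g.dist y y')) * M :=
          mul_le_mul_of_nonneg_right (mul_le_mul_of_nonneg_right (mul_le_mul_of_nonneg_right (le_add_of_nonneg_right hK₂) hcw) hE) hμ.nonneg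
      _ = ((∑ i, ‖b i‖) * M₂ * (B' / BG) + (∑ i, ‖b i‖) * M₂ * (B' / B₀)) * Bh * g.len y ^ (1 - β) * cζ *
            Real.exp (-(9 / 10 * δ₀ * g.dist y y')) * M := by ring
  · intro D Φ y p₀ hp₀ β Bh cζ hBh hcζ hhyp y' μ M hμ
    have hcw : 0 ≤ Bh * g.len y ^ (1 - β) * cζ := mul_nonneg (mul_nonneg hBh (Real.rpow_nonneg (hlen y).le _)) hcζ
    have key := norm_probe_transfer b (G := toB6 g Rr H) (fun q : (κ × S) × ι => blk q.1.2) (G₁ := G) (G₂ := GExt)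
      (E₁ := fun a a' => Real.exp (-(δ₀ * g.dist a a'))) (E₂ := fun a a' => Real.exp (-(δ₀ / 6 * g.dist a a')))
      hB₀' hM₂ (fun a a' => Real.exp_nonneg _) hrepr hGL D Φ p₀ hcw (fun z ν C hν => by
        have h1 := hhyp z ν C hν
        rw [show g.dist y z = g.dist (blk p₀.1.2) z by rw [hp₀]] at h1
        simpa only [mul_assoc] using h1) y' μ M hμ
    rw [hp₀] at key
    have hE : 0 ≤ Real.exp (-(δ₀ / 6 * g.dist y y')) := Real.exp_nonneg _
    calc ‖Φ ((coordEquiv b).symm (D (GExt μ)))‖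
        ≤ (∑ i, ‖b i‖) * M₂ * (B' / B₀) * (Bh * g.len y ^ (1 - β) * cζ) * Real.exp (-(δ₀ / 6 * g.dist y y')) * M := key
      _ ≤ ((∑ i, ‖b i‖) * M₂ * (B' / BG) + (∑ i, ‖b i‖) * M₂ * (B' / B₀)) * (Bh * g.len y ^ (1 - β) * cζ) *
            Real.exp (-(δ₀ / 6 * g.dist y y')) * M :=
          mul_le_mul_of_nonneg_right (mul_le_mul_of_nonneg_right (mul_le_mul_of_nonneg_right (le_add_of_nonneg_left hK₁) hcw) hE) hμ.nonneg
      _ = ((∑ i, ‖b i‖) * M₂ * (B' / BG) + (∑ i, ‖b i‖) * M₂ * (B' / B₀)) * Bh * g.len y ^ (1 - β) * cζ *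
            Real.exp (-(δ₀ / 6 * g.dist y y')) * M := by ring

end HolderU2

section HolderU3

variable {𝔸 : Type*} [NormedRing 𝔸] [NormedAlgebra ℂ 𝔸] [CompleteSpace 𝔸] {ι : Type} [Fintype ι]
variable (b : Module.Basis ι ℝ 𝔸) (κ : Type) [Fintype κ]

set_option maxHeartbeats 1600000 in
/-- **THEOREM 3.4, THE (3.43)-TYPE HÖLDER MEMBER OF `G′(U′U)` WITH THE DERIVATIVE ON THE RIGHT, CONSTANTS BEFORE THE LATTICE** («‖ζG′(U)∇*_Uλ‖_β ≦
B₀(β₀)(Lʲη)^{1−β}(‖ζ‖_β^ξ + |ζ|)e^{−δ₀d(y,y′)}|λ|», (3.43) p. 398; for `U′U`: p. 400; «the constants … do not depend on the sequence {Ω_j}», p. 399):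
`∃ a₁ > 0 ∃ B ≧ 0 ∀ (lattice, background, data, Theorem 3.1 for G′(U) = (Δ′_a(U))⁻¹) ∀ α₁ ≦ a₁ ∀ A ∈ (3.37) ∀ kF sF … ∀` right letter `D` with
`G′(U)·D ≺ B_G Lʲη e^{−δ₀d}` `∀ Φ y p₀ β B_h c_ζ`: IF (a) `‖Φ(G′(U)λ)‖ ≦ B_h(Lʲη)^{2−β}c_ζe^{−δ₀d(y,y′)}|λ|`, (b) `‖Φ(G′(U)∇_kλ)‖ ≦
B_h(Lʲη)^{1−β}c_ζe^{−δ₀d(y,y′)}|λ|` for every concrete `∇_k`, and (c) the same for `D`, THEN `‖Φ(G′(U′U)Dλ)‖ ≦ B·B_h(Lʲη)^{1−β}c_ζ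
e^{−(9δ₀/10)d(y,y′)}|λ|` — FILE 34 `thm34_Gp_holderRight_final` verbatim, re-quantified (the first form of (3.65) on the right letter, gen 9's left
composite applied to `X·G′(U)`, FILE 45's right-entry clause; `θ_L(1) ≦ K` by continuity and `Λ(1/25)` fixed before the lattice;
`B = (Σ_i‖b_i‖)M₂(1 + K·B⁽⁴⁵⁾Λ(1/25)c₁(δ₀, 1/25))`).
[cite: Balaban1985BackgroundPropagators, Thm 3.4 p.400 + p.399 + Thm 3.1 (3.42)–(3.43) pp.397–398 + (3.40) p.397 + (3.60)–(3.65) pp.402–403 + p.403 l.1–9; Balaban1984PropagatorsII, (2.51)–(2.55) p.232 + Lemma 2.1 p.234] -/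
theorem thm34_Gp_holderRight_uniform [DecidableEq ι] (d : ℕ)
    (δ₀ BG Cq a₀ d₀ M₂ : ℝ) (Λf : ℝ → ℝ)
    (hBG : 0 < BG) (hCq : 0 ≤ Cq) (ha₀ : 0 ≤ a₀) (hM₂ : 0 ≤ M₂) (hδ₀ : 0 < δ₀) (hΛf : ∀ α : ℝ, 0 < α → 1 ≤ Λf α)
    (hrepr : ∀ (v : 𝔸) (i : ι), |b.repr v i| ≤ M₂ * ‖v‖) :
    ∃ a₁ : ℝ, 0 < a₁ ∧ ∃ B : ℝ, 0 ≤ B ∧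
    ∀ {S : Type} [Fintype S] [DecidableEq S] (T : κ → Equiv.Perm S) (U : κ → S → 𝔸ˣ)
      {g : B9.Geometry} [Fintype g.Site] [DecidableEq g.Site] [Nonempty g.Site] {Rr : ℝ} {H : Prop} (blk : S → g.Site)
      (kQ : g.Site → S → 𝔸 →L[ℝ] 𝔸) (sQ : S → 𝔸 →L[ℝ] 𝔸) (cfun w : g.Site → ℝ)
    -- the multiscale geometry 𝔅 (p. 393, [4] (2.1)–(2.4)) and its axioms
    (hdnn : ∀ a a' : g.Site, 0 ≤ g.dist a a') (htri : Triangle254 (toB6 g Rr H)) (hrefl : ∀ y : g.Site, g.dist y y = 0)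
    (hsym : ∀ y y' : g.Site, g.dist y y' = g.dist y' y) (hlen : ∀ y : g.Site, 0 < g.len y) (hlenη : ∀ y : g.Site, g.eta ≤ g.len y)
    (hη : 0 < g.eta)
    -- [4] Lemma 2.1 (2.61) at the rate `δ₀`, «for every 0 < α < 1», and the p. 398 scale transfer for every exponent
    (h261 : ∀ α : ℝ, 0 < α → α < 1 → Ineq261 d (toB6 g Rr H) δ₀ α)
      (hST : ∀ α : ℝ, 0 < α → ScaleTransfer g δ₀ α (Λf α) (fun a => g.len a) ∧ ScaleTransfer g δ₀ α (Λf α) (fun a => g.len a ^ 2) ∧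
        ScaleTransfer g δ₀ α (Λf α) (fun a => (g.len a)⁻¹) ∧ ScaleTransfer g δ₀ α (Λf α) (fun a => (g.len a ^ 2)⁻¹) ∧
        ScaleTransfer g δ₀ α (Λf α) (fun a => (g.len a ^ 4)⁻¹) ∧ ScaleTransfer g δ₀ α (Λf α) (fun y => g.len y ^ (-(4 : ℝ))))
    (hU1 : ∀ m z, ‖((U m z : 𝔸ˣ) : 𝔸)‖ ≤ 1 ∧ ‖(((U m z)⁻¹ : 𝔸ˣ) : 𝔸)‖ ≤ 1)
    (hd₀B : ∀ μ x, g.dist (blk x) (blk ((T μ).symm x)) ≤ d₀) (hd₀F : ∀ μ x, g.dist (blk x) (blk (T μ x)) ≤ d₀)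
    (hd₀0 : ∀ y : g.Site, g.dist y y ≤ d₀)
    -- the `A`-independent data of the concrete `V′(A)` of (3.60)
    (hw : ∀ y, 0 ≤ w y) (hcard : ∀ y, ((B9Eq360Vprime.block blk y).card : ℝ) * w y ≤ 1)
    (hkQ : ∀ y x, blk x = y → ‖kQ y x‖ ≤ w y) (hsQ : ∀ x, ‖sQ x‖ ≤ 1) (hcfun : ∀ y, |cfun y| ≤ a₀ * (g.len y ^ 2)⁻¹)
    -- THEOREM 3.1 for `G′(U)`: (3.24) `G′(U) = (Δ′_a(U))⁻¹` for the letter `Δ′_a(U)`, and (3.42)₁,₂,₃ at the rate `δ₀`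
    {Δp Gp : Module.End ℝ (S × ι → ℝ)} (hΔpGp : Δp * Gp = 1) (hGpΔp : Gp * Δp = 1)
    (h342_1 : HasMajorant (g := toB6 g Rr H) (fun p : S × ι => blk p.1) Gp
      (fun a a' => BG * g.len a ^ 2 * Real.exp (-(δ₀ * g.dist a a'))))
    (h342_2 : ∀ k : κ ⊕ κ, HasMajorant (g := toB6 g Rr H) (fun p : S × ι => blk p.1)
      (conj b (diffLetter T U ((g.eta : ℂ)⁻¹) k) * Gp) (fun a a' => BG * g.len a * Real.exp (-(δ₀ * g.dist a a'))))
    (h342_3 : ∀ k : κ ⊕ κ, HasMajorant (g := toB6 g Rr H) (fun p : S × ι => blk p.1)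
      (Gp * conj b (diffLetter T U ((g.eta : ℂ)⁻¹) k)) (fun a a' => BG * g.len a * Real.exp (-(δ₀ * g.dist a a')))),
    ∀ (α₁ : ℝ), 0 ≤ α₁ → α₁ ≤ a₁ →
    -- the exponent field `A` in the domain (3.37), read blockwise, and the `A`-dependent (3.59) data `kF`, `sF`
    ∀ (A : κ → S → 𝔸) (kF : g.Site → S → 𝔸 →L[ℝ] 𝔸) (sF : S → 𝔸 →L[ℝ] 𝔸),
      (∀ y x, blk x = y → ‖kF y x‖ ≤ Cq * α₁ * w y) → (∀ x, ‖sF x‖ ≤ Cq * α₁) →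
      (∀ ν k x, ‖((g.eta : ℂ)⁻¹) • covDstar T U ν (A k) x‖ ≤ α₁ * (g.len (blk x) ^ 2)⁻¹) →
      (∀ μ ν x, ‖((g.eta : ℂ)⁻¹) • covD T U μ (A ν) x‖ ≤ α₁ * (g.len (blk x) ^ 2)⁻¹) →
      (∀ μ x, ‖((g.eta : ℂ)⁻¹) • covDstar T U μ (tauB T U μ (A μ)) x‖ ≤ α₁ * (g.len (blk x) ^ 2)⁻¹) →
      (∀ k x, ‖A k x‖ ≤ α₁ * (g.len (blk x))⁻¹) → (∀ ν k x, ‖tauB T U ν (A k) x‖ ≤ α₁ * (g.len (blk x))⁻¹) →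
      -- NEW: the (3.43)-type Hölder member with the derivative (any right letter `D` with a (3.42)₃-type entry) on the RIGHT
      ∀ (D : Module.End ℝ (S × ι → ℝ)),
        HasMajorant (g := toB6 g Rr H) (fun p : S × ι => blk p.1) (Gp * D) (fun a a' => BG * g.len a * Real.exp (-(δ₀ * g.dist a a'))) →
      ∀ (Φ : (S → 𝔸) →ₗ[ℝ] 𝔸) (y : g.Site) (p₀ : S × ι), blk p₀.1 = y →
      ∀ (β Bh cζ : ℝ), 0 ≤ Bh → 0 ≤ cζ →
        -- (a) the Hölder quotient of `ζG′(U)λ` itself (from (3.42)₂ in print; an input here)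
        (∀ (y' : g.Site) (μ : S × ι → ℝ) (M : ℝ), BlockSupp (g := toB6 g Rr H) (fun p : S × ι => blk p.1) μ y' M →
          ‖Φ ((coordEquiv b).symm (Gp μ))‖ ≤ Bh * g.len y ^ (2 - β) * cζ * Real.exp (-(δ₀ * g.dist y y')) * M) →
        -- (b) the member «‖ζG′(U)∇_kλ‖_β» for every concrete difference letter
        (∀ (k : κ ⊕ κ) (y' : g.Site) (μ : S × ι → ℝ) (M : ℝ), BlockSupp (g := toB6 g Rr H) (fun p : S × ι => blk p.1) μ y' M →
          ‖Φ ((coordEquiv b).symm ((Gp * conj b (diffLetter T U ((g.eta : ℂ)⁻¹) k)) μ))‖ ≤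
            Bh * g.len y ^ (1 - β) * cζ * Real.exp (-(δ₀ * g.dist y y')) * M) →
        -- (c) the member for the right letter `D`
        (∀ (y' : g.Site) (μ : S × ι → ℝ) (M : ℝ), BlockSupp (g := toB6 g Rr H) (fun p : S × ι => blk p.1) μ y' M →
          ‖Φ ((coordEquiv b).symm ((Gp * D) μ))‖ ≤ Bh * g.len y ^ (1 - β) * cζ * Real.exp (-(δ₀ * g.dist y y')) * M) →
        ∀ (y' : g.Site) (μ : S × ι → ℝ) (M : ℝ), BlockSupp (g := toB6 g Rr H) (fun p : S × ι => blk p.1) μ y' M →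
          ‖Φ ((coordEquiv b).symm (((gPrimeExtEnd Gp (conj b (vPrimeConc T U g.eta A blk kQ kF sQ sF cfun) * Gp)) * D) μ))‖ ≤
            B * Bh * g.len y ^ (1 - β) * cζ * Real.exp (-(9 / 10 * δ₀ * g.dist y y')) * M := by
  classical
  -- the scale-transfer constants of the chain, READ FROM THE GIVEN FUNCTION `Λf` (lattice-free)
  have hΛ : 1 ≤ Λf (1 / 100) := hΛf _ (by norm_num)
  have hΛ'1 : 1 ≤ Λf (1 / 25) := hΛf _ (by norm_num)
  obtain ⟨a₁, ha₁, B', hB', HA⟩ := thm34_Gp_uniform b κ d δ₀ BG Cq a₀ d₀ M₂ Λf hBG hCq ha₀ hM₂ hδ₀ hΛf hrepr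
  have hSb : 0 ≤ ∑ i, ‖b i‖ := Finset.sum_nonneg fun i _ => norm_nonneg _
  have hΛ0 : 0 ≤ (Λf (1 / 100)) := zero_le_one.trans hΛ
  have hΛ'0 : 0 ≤ (Λf (1 / 25)) := zero_le_one.trans hΛ'1
  have hc1' : 0 ≤ B6.c1 d δ₀ (1 / 25) := B6RandomWalk.c1_nonneg d δ₀ (1 / 25)
  -- «for α₁ sufficiently small»: the unit-normalised `θ_L(1)` is continuous at `α₁ = 0`, hence bounded below a threshold
  obtain ⟨K, ε, hK, hε, hKb⟩ := exists_bound_of_continuousAt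
    (f := fun α₁ : ℝ => thetaL363 (Fintype.card κ) 1 α₁ a₀ Cq M₂ (∑ i, ‖b i‖) (Real.exp (δ₀ * d₀)) 1 (Λf (1 / 100)) (B6.c1 d δ₀ (1 / 100)))
    (by unfold thetaL363 kappa385 cVConc cBConc; fun_prop)
  have hBfin : 0 ≤ (∑ i, ‖b i‖) * M₂ * (1 + K * B' * (Λf (1 / 25)) * B6.c1 d δ₀ (1 / 25)) :=
    mul_nonneg (mul_nonneg hSb hM₂) (by positivity)
  refine ⟨min (min a₁ (1 / 4)) (ε / 2), lt_min (lt_min ha₁ (by norm_num)) (half_pos hε),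
    (∑ i, ‖b i‖) * M₂ * (1 + K * B' * (Λf (1 / 25)) * B6.c1 d δ₀ (1 / 25)), hBfin, ?_⟩
  -- NOW the lattice, the background, the data, the Theorems-for-`U` inputs (block and kernel members); then `α₁`, `A` and the `A`-letters
  intro S _ _ T U g _ _ _ Rr H blk kQ sQ cfun w hdnn htri hrefl hsym hlen hlenη hη h261 hST hU1 hd₀B hd₀F hd₀0 hw hcard hkQ hsQ hcfun Δp Gp hΔpGp
    hGpΔp h342_1 h342_2 h342_3 α₁ hα₁0 hα₁1 A kF sF hkF hsF h337B h337F h337Bτ hA hAτB D hGpD Φ y p₀ hp₀ β Bh cζ hBh hcζ h0 hR hD y' μ M hμ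
  obtain ⟨y₀⟩ := ‹Nonempty g.Site›
  replace HA := HA T U blk kQ sQ cfun w hdnn htri hrefl hsym hlen hlenη hη h261 hST hU1 hd₀B hd₀F hd₀0 hw hcard hkQ hsQ hcfun hΔpGp hGpΔp h342_1
    h342_2 h342_3
  -- the p. 398 scale transfers and [4] Lemma 2.1 at the exponents `1/100` (gen 9's left composite) and `1/25` (the final composition)
  obtain ⟨-, -, hT1i, hT2i, -, -⟩ := hST (1 / 100) (by norm_num)
  obtain ⟨hT1', -, -, -, -, -⟩ := hST (1 / 25) (by norm_num)
  have h261β : Ineq261 d (toB6 g Rr H) δ₀ (1 / 100) := h261 _ (by norm_num) (by norm_num)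
  have h261' : Ineq261 d (toB6 g Rr H) δ₀ (1 / 25) := h261 _ (by norm_num) (by norm_num)
  have hα₁a : α₁ ≤ a₁ := hα₁1.trans ((min_le_left _ _).trans (min_le_left _ _))
  have hα₁q : α₁ ≤ 1 / 4 := hα₁1.trans ((min_le_left _ _).trans (min_le_right _ _))
  have hα₁ε : |α₁| < ε := by rw [abs_of_nonneg hα₁0]; linarith only [hα₁1, min_le_right (min a₁ (1 / 4)) (ε / 2), hε]
  obtain ⟨i1, -, -, hGpR⟩ := HA α₁ hα₁0 hα₁a A kF sF hkF hsF h337B h337F h337Bτ hA hAτB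
  -- names
  set V : Module.End ℝ (S × ι → ℝ) := (conj b (vPrimeConc T U g.eta A blk kQ kF sQ sF cfun)) with hVdef
  set E : Module.End ℝ (S × ι → ℝ) := (gPrimeExtEnd Gp (conj b (vPrimeConc T U g.eta A blk kQ kF sQ sF cfun) * Gp)) with hEdef
  -- (3.65)₁ from the two-sided inverse: `E = G′ + G′V′E`, read on the right letter `D`
  have hE : E = Gp + Gp * V * E := by
    have e1 : Gp * ((Δp - V) * E) = Gp := by rw [i1, mul_one]
    have e2 : Gp * ((Δp - V) * E) = E - Gp * V * E := by
      rw [sub_mul, mul_sub, ← mul_assoc, hGpΔp, one_mul, mul_assoc]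
    rw [e2] at e1
    exact (sub_eq_iff_eq_add.mp e1)
  have hED : E * D = Gp * D + Gp * V * (E * D) := by
    conv_lhs => rw [hE]
    rw [add_mul]
    simp only [mul_assoc]
  -- the anchor: from now on `y` is the block of `p₀`
  subst hp₀
  -- the constant of the point-probe composite and the two rescalings of the printed weights
  have hℓ : 0 < g.len (blk p₀.1) := hlen _
  set B₀' : ℝ := M₂ * (Bh * g.len (blk p₀.1) ^ (1 - β) * cζ) * (g.len (blk p₀.1))⁻¹ with hB₀'def
  have hB₀'0 : 0 ≤ B₀' := mul_nonneg (mul_nonneg hM₂ (mul_nonneg (mul_nonneg hBh (Real.rpow_nonneg hℓ.le _)) hcζ)) (inv_nonneg.mpr hℓ.le)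
  have hpow : g.len (blk p₀.1) ^ (2 - β) = g.len (blk p₀.1) ^ (1 - β) * g.len (blk p₀.1) := by
    rw [show (2 : ℝ) - β = (1 - β) + 1 by ring, Real.rpow_add hℓ, Real.rpow_one]
  have hB1 : B₀' * g.len (blk p₀.1) = M₂ * (Bh * g.len (blk p₀.1) ^ (1 - β) * cζ) := by
    rw [hB₀'def]; field_simp
  have hB2 : B₀' * g.len (blk p₀.1) ^ 2 = M₂ * (Bh * g.len (blk p₀.1) ^ (2 - β) * cζ) := by
    rw [hpow, hB₀'def]; field_simp
  -- the exponential weights are nonnegative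
  have hE₀ : ∀ a a' : g.Site, 0 ≤ Real.exp (-(δ₀ * g.dist a a')) := fun a a' => Real.exp_nonneg _
  -- per real coordinate `i` of `Φ`: the point probe `Xᵢ` and the three majorants of `Xᵢ·G′(U)`, `Xᵢ·G′(U)∇_k`, `Xᵢ·G′(U)D`
  have hcoord : ∀ i : ι,
      |((b.coord i) ∘ₗ Φ ∘ₗ (coordEquiv (S := S) b).symm.toLinearMap) ((E * D) μ)| ≤
        (B₀' * (1 + K * B' * (Λf (1 / 25)) * B6.c1 d δ₀ (1 / 25))) * g.len (blk p₀.1) * Real.exp (-(9 / 10 * δ₀ * g.dist (blk p₀.1) y')) * M := by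
    intro i
    set X : Module.End ℝ (S × ι → ℝ) :=
      (LinearMap.single ℝ (fun _ : S × ι => ℝ) p₀) ∘ₗ ((b.coord i) ∘ₗ Φ ∘ₗ (coordEquiv (S := S) b).symm.toLinearMap) with hXdef
    -- (a) ⇒ `X·G′ ≺ B₀′(Lʲη)²e^{−δ₀d}`
    have hX1 : HasMajorant (g := toB6 g Rr H) (fun p : S × ι => blk p.1) (X * Gp)
        (fun a a' => B₀' * g.len a ^ 2 * Real.exp (-(δ₀ * g.dist a a'))) := by
      refine hasMajorant_pointProbe_mul (G := toB6 g Rr H) (fun p : S × ι => blk p.1) p₀ _ Gp _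
        (fun a a' => mul_nonneg (mul_nonneg hB₀'0 (sq_nonneg _)) (hE₀ a a')) fun z ν C hν => ?_
      rw [coordProbe_apply]
      calc |b.repr (Φ ((coordEquiv b).symm (Gp ν))) i| ≤ M₂ * ‖Φ ((coordEquiv b).symm (Gp ν))‖ := hrepr _ _
        _ ≤ M₂ * (Bh * g.len (blk p₀.1) ^ (2 - β) * cζ * Real.exp (-(δ₀ * g.dist (blk p₀.1) z)) * C) :=
            mul_le_mul_of_nonneg_left (h0 z ν C hν) hM₂
        _ = B₀' * g.len (blk p₀.1) ^ 2 * Real.exp (-(δ₀ * g.dist (blk p₀.1) z)) * C := by rw [hB2]; ring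
    -- (b) ⇒ `X·G′∇_k ≺ B₀′Lʲη e^{−δ₀d}`
    have hX3 : ∀ k : κ ⊕ κ, HasMajorant (g := toB6 g Rr H) (fun p : S × ι => blk p.1) (X * Gp * conj b (diffLetter T U ((g.eta : ℂ)⁻¹) k))
        (fun a a' => B₀' * g.len a * Real.exp (-(δ₀ * g.dist a a'))) := by
      intro k
      rw [mul_assoc]
      refine hasMajorant_pointProbe_mul (G := toB6 g Rr H) (fun p : S × ι => blk p.1) p₀ _ _ _
        (fun a a' => mul_nonneg (mul_nonneg hB₀'0 (hlen a).le) (hE₀ a a')) fun z ν C hν => ?_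
      rw [coordProbe_apply]
      calc |b.repr (Φ ((coordEquiv b).symm ((Gp * conj b (diffLetter T U ((g.eta : ℂ)⁻¹) k)) ν))) i|
          ≤ M₂ * ‖Φ ((coordEquiv b).symm ((Gp * conj b (diffLetter T U ((g.eta : ℂ)⁻¹) k)) ν))‖ := hrepr _ _
        _ ≤ M₂ * (Bh * g.len (blk p₀.1) ^ (1 - β) * cζ * Real.exp (-(δ₀ * g.dist (blk p₀.1) z)) * C) :=
            mul_le_mul_of_nonneg_left (hR k z ν C hν) hM₂
        _ = B₀' * g.len (blk p₀.1) * Real.exp (-(δ₀ * g.dist (blk p₀.1) z)) * C := by rw [hB1]; ring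
    -- (c) ⇒ `X·G′D ≺ B₀′Lʲη e^{−δ₀d}`, rate weakened to `9δ₀/10`
    have hXD : HasMajorant (g := toB6 g Rr H) (fun p : S × ι => blk p.1) (X * (Gp * D))
        (fun a a' => B₀' * g.len a * Real.exp (-(9 / 10 * δ₀ * g.dist a a'))) := by
      refine hasMajorant_rate_mono (R := Rr) (H := H) (r := δ₀) (fun p : S × ι => blk p.1) B₀' (fun a => g.len a) hB₀'0 (fun a => (hlen a).le)
        (by linarith only [hδ₀]) hdnn ?_
      refine hasMajorant_pointProbe_mul (G := toB6 g Rr H) (fun p : S × ι => blk p.1) p₀ _ _ _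
        (fun a a' => mul_nonneg (mul_nonneg hB₀'0 (hlen a).le) (hE₀ a a')) fun z ν C hν => ?_
      rw [coordProbe_apply]
      calc |b.repr (Φ ((coordEquiv b).symm ((Gp * D) ν))) i| ≤ M₂ * ‖Φ ((coordEquiv b).symm ((Gp * D) ν))‖ := hrepr _ _
        _ ≤ M₂ * (Bh * g.len (blk p₀.1) ^ (1 - β) * cζ * Real.exp (-(δ₀ * g.dist (blk p₀.1) z)) * C) :=
            mul_le_mul_of_nonneg_left (hD z ν C hν) hM₂
        _ = B₀' * g.len (blk p₀.1) * Real.exp (-(δ₀ * g.dist (blk p₀.1) z)) * C := by rw [hB1]; ring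
    -- gen 9's LEFT COMPOSITE for the operator `X·G′(U)`: `(X·G′)·V′ ≺ θ_L(B₀′)e^{−(49δ₀/50)d}`
    have hsmall : ∀ z : g.Site, g.eta * (α₁ * (g.len z)⁻¹) ≤ 1 / 4 := fun z => by
      have hq : g.eta * (g.len z)⁻¹ ≤ 1 := by
        rw [← div_eq_mul_inv]; exact (div_le_one (hlen z)).mpr (hlenη z)
      calc g.eta * (α₁ * (g.len z)⁻¹) = α₁ * (g.eta * (g.len z)⁻¹) := by ring
        _ ≤ α₁ * 1 := mul_le_mul_of_nonneg_left hq hα₁0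
        _ ≤ 1 / 4 := by linarith only [hα₁q]
    have hA' : ∀ m x, ‖A m x‖ ≤ α₁ * (g.len (blk x))⁻¹ ∧ ‖tauB T U m (A m) x‖ ≤ α₁ * (g.len (blk x))⁻¹ :=
      fun m x => ⟨hA m x, hAτB m m x⟩
    have h337s' : ∀ m x, ‖((g.eta : ℂ)⁻¹) • covDstar T U m (A m) x‖ ≤ α₁ * (g.len (blk x) ^ 2)⁻¹ := fun m x => h337B m m x
    have h337F' : ∀ m x, ‖((g.eta : ℂ)⁻¹) • covD T U m (A m) x‖ ≤ α₁ * (g.len (blk x) ^ 2)⁻¹ := fun m x => h337F m m x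
    have hd₀' : ∀ m x, g.dist (blk x) (blk (T m x)) ≤ d₀ ∧ g.dist (blk x) (blk ((T m).symm x)) ≤ d₀ :=
      fun m x => ⟨hd₀F m x, hd₀B m x⟩
    have hrc1 : 49 / 50 * δ₀ + (1 / 100 + 1 / 100) * δ₀ ≤ δ₀ := by linarith only [hδ₀]
    have hXV := hasMajorant_gp_vPrime (Rr := Rr) (H := H) b T U blk d hη A kQ kF sQ sF cfun w 1 d₀ M₂ Cq a₀ δ₀ δ₀ (1 / 100) (1 / 100)
      (49 / 50 * δ₀) (Λf (1 / 100)) B₀' α₁ hB₀'0 hα₁0 hΛ0 (by linarith only [hδ₀]) (by norm_num) (by norm_num) hδ₀.le hδ₀.le hrc1 hdnn htri hlen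
      h261β hT1i hT2i hM₂ hrepr hsmall hA' h337s' h337F' h337Bτ hU1 hd₀' hd₀0 hw hcard hCq ha₀ hkQ hkF hsQ hsF hcfun hX1 hX3
    rw [thetaL363_linear] at hXV
    -- `θ_L(1) ≦ K` below the threshold
    have hθK : thetaL363 (Fintype.card κ) 1 α₁ a₀ Cq M₂ (∑ i, ‖b i‖) (Real.exp (δ₀ * d₀)) 1 (Λf (1 / 100)) (B6.c1 d δ₀ (1 / 100)) ≤ K := hKb α₁ hα₁ε
    have hθ0 : 0 ≤ thetaL363 (Fintype.card κ) 1 α₁ a₀ Cq M₂ (∑ i, ‖b i‖) (Real.exp (δ₀ * d₀)) 1 (Λf (1 / 100)) (B6.c1 d δ₀ (1 / 100)) :=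
      thetaL363_nonneg hα₁0 ha₀ hCq hM₂ hSb (Real.exp_nonneg _) zero_le_one hΛ0 (B6RandomWalk.c1_nonneg d δ₀ (1 / 100))
    -- FILE 26's right entry `E·D ≺ B₂₆Lʲη e^{−(9δ₀/10)d}` and the composition [4] (2.52)–(2.55) + Lemma 2.1 at `1/25`
    have hT₂ := hGpR D hGpD
    have hr' : 9 / 10 * δ₀ + (1 / 25 + 1 / 25) * δ₀ ≤ 49 / 50 * δ₀ := by linarith only [hδ₀]
    have hcomp := hasMajorant_comp_decay_left1 (R := Rr) (H := H) (fun p : S × ι => blk p.1) d δ₀ (1 / 25) (1 / 25) (9 / 10 * δ₀) (49 / 50 * δ₀) (Λf (1 / 25))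
      (B₀' * thetaL363 (Fintype.card κ) 1 α₁ a₀ Cq M₂ (∑ i, ‖b i‖) (Real.exp (δ₀ * d₀)) 1 (Λf (1 / 100)) (B6.c1 d δ₀ (1 / 100))) B'
      (fun a => g.len a) (fun a => (hlen a).le) hΛ'0 (mul_nonneg hB₀'0 hθ0) hB' (by linarith only [hδ₀]) hr' hdnn htri hT1' h261'
      hXV hT₂
    -- sum of the two pieces: `X·(E·D) = X·(G′D) + (X·G′·V′)·(E·D)`
    have hsplit : X * (E * D) = X * (Gp * D) + X * Gp * V * (E * D) := by
      conv_lhs => rw [hED]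
      rw [mul_add]
      simp only [mul_assoc]
    have hsum := hasMajorant_add (g := toB6 g Rr H) (fun p : S × ι => blk p.1) hXD hcomp
    rw [← hsplit] at hsum
    have hfin : HasMajorant (g := toB6 g Rr H) (fun p : S × ι => blk p.1) (X * (E * D))
        (fun a a' => (B₀' * (1 + K * B' * (Λf (1 / 25)) * B6.c1 d δ₀ (1 / 25))) * g.len a * Real.exp (-(9 / 10 * δ₀ * g.dist a a'))) := by
      refine hasMajorant_mono (g := toB6 g Rr H) _ hsum fun a a' => ?_
      have hw' : 0 ≤ g.len a * Real.exp (-(9 / 10 * δ₀ * g.dist a a')) := mul_nonneg (hlen a).le (Real.exp_nonneg _)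
      have hθle : B₀' * thetaL363 (Fintype.card κ) 1 α₁ a₀ Cq M₂ (∑ i, ‖b i‖) (Real.exp (δ₀ * d₀)) 1 (Λf (1 / 100)) (B6.c1 d δ₀ (1 / 100)) * B' * (Λf (1 / 25)) *
          B6.c1 d δ₀ (1 / 25) ≤ B₀' * K * B' * (Λf (1 / 25)) * B6.c1 d δ₀ (1 / 25) :=
        mul_le_mul_of_nonneg_right (mul_le_mul_of_nonneg_right (mul_le_mul_of_nonneg_right
          (mul_le_mul_of_nonneg_left hθK hB₀'0) hB') hΛ'0) hc1'
      calc B₀' * g.len a * Real.exp (-(9 / 10 * δ₀ * g.dist a a')) +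
            B₀' * thetaL363 (Fintype.card κ) 1 α₁ a₀ Cq M₂ (∑ i, ‖b i‖) (Real.exp (δ₀ * d₀)) 1 (Λf (1 / 100)) (B6.c1 d δ₀ (1 / 100)) * B' * (Λf (1 / 25)) *
              B6.c1 d δ₀ (1 / 25) * g.len a * Real.exp (-(9 / 10 * δ₀ * g.dist a a'))
          = (B₀' + B₀' * thetaL363 (Fintype.card κ) 1 α₁ a₀ Cq M₂ (∑ i, ‖b i‖) (Real.exp (δ₀ * d₀)) 1 (Λf (1 / 100)) (B6.c1 d δ₀ (1 / 100)) * B' * (Λf (1 / 25)) *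
              B6.c1 d δ₀ (1 / 25)) * (g.len a * Real.exp (-(9 / 10 * δ₀ * g.dist a a'))) := by ring
        _ ≤ (B₀' + B₀' * K * B' * (Λf (1 / 25)) * B6.c1 d δ₀ (1 / 25)) * (g.len a * Real.exp (-(9 / 10 * δ₀ * g.dist a a'))) :=
            mul_le_mul_of_nonneg_right (add_le_add le_rfl hθle) hw'
        _ = (B₀' * (1 + K * B' * (Λf (1 / 25)) * B6.c1 d δ₀ (1 / 25))) * g.len a * Real.exp (-(9 / 10 * δ₀ * g.dist a a')) := by ring
    have hread := probe_le_of_hasMajorant_pointProbe_mul (G := toB6 g Rr H) (fun p : S × ι => blk p.1) p₀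
      ((b.coord i) ∘ₗ Φ ∘ₗ (coordEquiv (S := S) b).symm.toLinearMap) (E * D) _ hfin y' μ M hμ
    simpa only [coordProbe_apply] using hread
  -- from the coordinates to the norm
  have hn := norm_le_sum_norm_mul_of_repr_le b (Φ ((coordEquiv b).symm ((E * D) μ))) _ (fun i => by
    simpa only [coordProbe_apply] using hcoord i)
  calc ‖Φ ((coordEquiv b).symm ((E * D) μ))‖
      ≤ (∑ i, ‖b i‖) * ((B₀' * (1 + K * B' * (Λf (1 / 25)) * B6.c1 d δ₀ (1 / 25))) * g.len (blk p₀.1) *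
          Real.exp (-(9 / 10 * δ₀ * g.dist (blk p₀.1) y')) * M) := hn
    _ = (∑ i, ‖b i‖) * M₂ * (1 + K * B' * (Λf (1 / 25)) * B6.c1 d δ₀ (1 / 25)) * Bh * g.len (blk p₀.1) ^ (1 - β) * cζ *
          Real.exp (-(9 / 10 * δ₀ * g.dist (blk p₀.1) y')) * M := by
        have e : (∑ i, ‖b i‖) * ((B₀' * (1 + K * B' * (Λf (1 / 25)) * B6.c1 d δ₀ (1 / 25))) * g.len (blk p₀.1) *
            Real.exp (-(9 / 10 * δ₀ * g.dist (blk p₀.1) y')) * M) =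
            (∑ i, ‖b i‖) * (1 + K * B' * (Λf (1 / 25)) * B6.c1 d δ₀ (1 / 25)) * (B₀' * g.len (blk p₀.1)) *
            Real.exp (-(9 / 10 * δ₀ * g.dist (blk p₀.1) y')) * M := by ring
        rw [e, hB1]; ring

end HolderU3

end Literature.MathematicalPhysics.QuantumFieldTheory.Balaban1983to89.B9Thm34HolderLeftUniform

end
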